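import Literature.Geometry.Lorentzian.GiorgiKlainermanSzeftel2022.CurvatureEstimateShapes

/-!
# Giorgi–Klainerman–Szeftel §15.1.3: Theorem 13.6.3 (control of the top-order curvature norms) assembled from Thm 14.1.3, Props 15.1.1–15.1.2 and Thm 16.1.1 — the arithmetic, kernel-checked over the statement shapes of `CurvatureEstimateShapes`

CITATION HEADER (lean-in-tree rule 2026-08-18).  Source: E. Giorgi, S. Klainerman, J. Szeftel, *Wave equations estimates
and the nonlinear stability of slowly rotating Kerr black holes*, arXiv:2205.14808 (v1, 2022; TeX source
`FinalKerrarxivversion.tex`, lines quoted as `l.N`) = bib key `GiorgiKlainermanSzeftel2022`; refereed version Pure Appl.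
Math. Q. **20** (2024) no. 7, 2865–3849 = `GiorgiKlainermanSzeftel2024` (held by the audit cell as
`paper:doi-10-4310-pamq-241128023033`; same theorem numbers in Part III, cell CONCORDANCE.md).  The manuscript is UNDER
ADJUDICATION by the audit cell (FSC near-miss cell 6, `|a| ≪ M` Kerr stability): nothing in it is cited here as a fact —
every display of [GKS] enters as a HYPOTHESIS (a statement shape of `CurvatureEstimateShapes` with its hidden constant
explicit) of a kernel-checked implication.

WHAT IS REPRODUCED, and in what sense.  The node "GKS13.6.3 ⇐ 14.1.3 + 15.1.1 + 15.1.2 + 16.1.1" of the cell's DAG —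
GKS §15.1.3 "Proof of (13.6.6) in Theorem 13.6.3", l.27221–27266, one page of inequalities between the Morawetz–energy
norms `BEF_δ^J[·]` of the curvature components and the main norms `𝔖, ℜ` — PROVED as real arithmetic:
* Part A: elementary helpers (`√(x+y) ≤ √x + √y`, `√K ≤ 1 + K`, the dichotomy `M S ≤ S √(M S) + M²`, `√(ρ^15) = ρ^7 √ρ`);
* Part B: `partIII_arith` — from the iteration assumption (13.6.4) and the displayed inequalities of Thm 14.1.3,
  Prop 15.1.1, Prop 15.1.2 (hidden constants `K₁, K₂, K₃`) follows the display l.27250–27256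
  `BEF_δ^J[A,B,P̌,B̲,A̲] ≤ C·(r₀^{15}(ε_J(𝔖_{J+1}+ℜ_{J+1}) + ε_J² + ε₀²) + |a|𝔖²_{J+1} + r₀^{15/4}𝔖_{J+1}^{3/2}(ε₀ + √ε_J√(𝔖+ℜ))^{1/2})`
  with `C = partIIIConst K₁ K₂ K₃` an explicit polynomial;
* Part C: `rpow_form` (the last term in the `Real.rpow` form of the tree's shape), the comparison shape `RintFromBEF`
  (= step (iv), "in view of the definitions", l.27262–27264, hidden constant `K₄`), and the assembled
  `controlOfCurvature_GKS_of_parts : MorawetzEnergyPc K₁ → EstimatesBBb K₂ → EstimatesAAb K₃ → RintFromBEF K₄ →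
  MainResultMext K₁₆ → (signs, r₀ ≥ 1, |a| ≤ 1) → ControlOfCurvature_GKS (curvConst K₁ K₂ K₃ K₄ K₁₆)`, plus the journal
  display `controlOfCurvature_GKSj_of_parts`.

KERNEL REMARKS recorded in the docstrings (divergence notes for the cell, not claims about the mathematics of [GKS];
they sharpen the cell's referee entry GAPS.md E16, which certified this edge by hand): (i) the intermediate term
`r₀^{15/2} 𝔖_{J+1}(ε₀ + √ε_J √(𝔖_{J+1}+ℜ_{J+1}))` of l.27238–27241 does not appear in l.27250–27256; it is dominated by the
two displayed terms by a dichotomy on `𝔖_{J+1} ≷ r₀^{15/2}(ε₀ + √ε_J√(𝔖+ℜ))` (`mul_le_sqrt_add_sq`) — a step the text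
leaves to the reader; (ii) `|a|²𝔖² ≤ |a|𝔖²` (l.27250) needs `|a| ≤ 1` (E16 N3), an explicit hypothesis here; (iii) the
symbol `BEF_δ^J[A,B,P̌,B̲,A̲]` is read as the SUM of the five norms (E16 N2); (iv) the shapes leave the signs of the norms
implicit — `𝔖, ℜ, BEF ≥ 0`, `ε_J, ε₀ ≥ 0` are hypotheses; (v) the output constant `curvConst` is independent of `r₀`,
as [GKS] states ("the constant in ≲ is independent of r₀"), GIVEN that the hidden constants of the four leaves are;
(vi) the hypotheses (13.6.1)–(13.6.3), (13.6.5) of Thm 13.6.3 are threaded through unused at this node; (vii) on the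
exponent of `|a|` (the source prints `|a|²𝔖²_{J+1}` in the statements of Props 15.1.1/15.1.2 and `|a|𝔖²_{J+1}` in the
closing lines of their proofs — recorded, unresolved, in `CurvatureEstimateShapes`): with the STATEMENT reading `|a|²`
(the tree's shapes, used here) the display l.27250–27255 follows, its `|a|𝔖²` arising as `√(|a|²𝔖²)·𝔖` from the term
`√(δ_{J+1}[B])·𝔖_{J+1}` plus `|a|² ≤ |a|`; under the alternative reading `|a|𝔖²` the same arithmetic gives only
`√|a|·𝔖²_{J+1}` there (worst case `δ_{J+1}[B] ≈ |a|𝔖²`), which GKS Remark 13.6.4 would absorb under `√|a|·r₀³ ≪ 1`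
instead of `|a|·r₀³ ≪ 1` — an observation about what the displayed inequalities imply, not formalised.

RELATION TO EXISTING TREE MATERIAL.  Consumes `CurvatureEstimateShapes.lean` (shapes `CurvBEFData`, `MorawetzEnergyPc`,
`EstimatesBBb`, `EstimatesAAb`, `MainResultMext`, `ControlOfCurvature_GKS/_GKSj`, name-stable) and through it
`EstimateShapes.lean` (`KerrParams`, `Fixed`, `Small`, `rp`).  Downstream in the cell's DAG, `ControlOfCurvature_GKS`
feeds KS Cor 9.4.21 via GKS Remark 13.6.4 (`KlainermanSzeftel2021.IterationAbsorption`, `…IterationStep`).  No relation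
to `StabilityCauchy.lean` / `Stability.lean` / `Kerr*.lean` / the Hintz claim file.  Nothing here is
Final-State-Conjecture progress: value = a kernel-checked bookkeeping edge of a typed skeleton (cell LEMMAS.md §4 row
"GKS13.6.3 ⇐ 14.1.3 + 15.1.1 + 15.1.2 + 16.1.1").

Proofs: elementary real analysis, 0 sorry, axioms ⊆ {propext, Classical.choice, Quot.sound}.
-/

noncomputable section

namespace Literature.Geometry.Lorentzian.GiorgiKlainermanSzeftel2022.CurvatureAssembly

open Literature.Geometry.Lorentzian.GiorgiKlainermanSzeftel2022.EstimateShapes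
open Literature.Geometry.Lorentzian.GiorgiKlainermanSzeftel2022.CurvatureEstimateShapes

/-! ## Part A. Elementary real-analysis helpers. -/

/-- Subadditivity of the square root: `√(x + y) ≤ √x + √y` for `x, y ≥ 0` (cf.
`Literature.NumberTheory.LFunctions.MRT2015.sqrt_add_le_sqrt_add_sqrt`, identical, not in this topic's import closure —
kept private here rather than importing the analytic-number-theory chain into Lorentzian geometry). [folklore] -/
private theorem sqrt_add_le {x y : ℝ} (hx : 0 ≤ x) (hy : 0 ≤ y) : Real.sqrt (x + y) ≤ Real.sqrt x + Real.sqrt y := by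
  rw [Real.sqrt_le_left (by positivity)]
  have h1 := Real.sq_sqrt hx
  have h2 := Real.sq_sqrt hy
  nlinarith [Real.sqrt_nonneg x, Real.sqrt_nonneg y]

/-- `√K ≤ 1 + K` (cf. `Literature.NumberTheory.Sieve.BFI.L1.sqrt_le_one_add`, identical, not in this topic's import closure — private for the same reason) for `K ≥ 0`. [folklore] -/
private theorem sqrt_le_one_add {K : ℝ} (hK : 0 ≤ K) : Real.sqrt K ≤ 1 + K := by
  rw [Real.sqrt_le_left (by positivity)]
  nlinarith

/-- The dichotomy behind the `𝔖^{3/2}` term of GKS (13.6.6): for `S, M ≥ 0`, `M·S ≤ S·√(M·S) + M²`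
(if `M ≤ S` then `M S = √(M·M)·S ≤ √(M S)·S`; if `S ≤ M` then `M S ≤ M²`). [folklore] -/
private theorem mul_le_sqrt_add_sq {S M : ℝ} (hS : 0 ≤ S) (hM : 0 ≤ M) :
    M * S ≤ S * Real.sqrt (M * S) + M ^ 2 := by
  have hsq : 0 ≤ S * Real.sqrt (M * S) := mul_nonneg hS (Real.sqrt_nonneg _)
  rcases le_total M S with hMS | hSM
  · have h1 : M ≤ Real.sqrt (M * S) := by
      rw [Real.le_sqrt hM (by positivity)]
      nlinarith
    nlinarith [mul_le_mul_of_nonneg_left h1 hS]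
  · nlinarith [mul_le_mul_of_nonneg_left hSM hM]

/-- `√(ρ^15) = ρ^7 √ρ` for `ρ ≥ 0`. [folklore] -/
private theorem sqrt_pow_fifteen {ρ : ℝ} (hρ : 0 ≤ ρ) : Real.sqrt (ρ ^ 15) = ρ ^ 7 * Real.sqrt ρ := by
  have h : ρ ^ 15 = (ρ ^ 7 * Real.sqrt ρ) ^ 2 := by
    rw [mul_pow, Real.sq_sqrt hρ]; ring
  rw [h, Real.sqrt_sq (by positivity)]

/-! ## Part B. The arithmetic of GKS §15.1.3 (proof of (13.6.6)), kernel-checked. -/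

/-- The explicit constant of the §15.1.3 assembly as a polynomial in the hidden constants `K₁` (Thm 14.1.3), `K₂`
(Prop 15.1.1), `K₃` (Prop 15.1.2). [cite: GiorgiKlainermanSzeftel2022, §15.1.3, TeX l.27221–27266] -/
def partIIIConst (K1 K2 K3 : ℝ) : ℝ :=
  (K1 + (1 + K3) * (K2 * (2 * K1 + 4)) + 4 * K3 + 2 * K3 * (1 + K2 * (2 * K1 + 4)))
  + 2 * ((1 + K3) * (K2 * (K1 + 2)) + 2 * K3 + 2 * K3 * (1 + K2 * (2 * K1 + 4)))
  + ((1 + K3) * K2 + 2 * K3 + 2 * K3 * (1 + K2))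
  + 2 * K3 * (1 + K2 * (K1 + 2))

/-- `partIIIConst ≥ 0`. [folklore] -/
theorem partIIIConst_nonneg {K1 K2 K3 : ℝ} (hK1 : 0 ≤ K1) (hK2 : 0 ≤ K2) (hK3 : 0 ≤ K3) :
    0 ≤ partIIIConst K1 K2 K3 := by
  unfold partIIIConst; positivity

/-- **The §15.1.3 arithmetic** (GKS l.27221–27261), kernel-checked with an explicit constant.  Variables: `dP = BEF_δ^J[r²P̌]`,
`dB = BEF_δ^J[r²B]`, `dBb = BEF_δ^J[B̲]`, `aA = BEF_δ^J[r²A]`, `aAb = BEF_δ^J[A̲]` (`dB, dBb ≥ 0`), `S1 = 𝔖_{J+1}`,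
`R1 = ℜ_{J+1}`, `SJ = 𝔖_J`, `RJ = ℜ_J` (`≥ 0`), `e = ε_J`, `e0 = ε₀` (`≥ 0`), `α = |a| ∈ [0,1]`, `ρ = r₀ ≥ 1`.
HYPOTHESES: the iteration assumption (13.6.4) `𝔖_J + ℜ_J ≤ ε_J`; Thm 14.1.3 (`h1`); Prop 15.1.1 (`h2`); Prop 15.1.2 (`h3a`,
`h3b`) — the displayed inequalities with hidden constants `K₁, K₂, K₃ ≥ 0`.  CONCLUSION: the display l.27250–27256,
`BEF_δ^J[A,B,P̌,B̲,A̲] ≤ C (r₀^{15}(ε_J(𝔖_{J+1}+ℜ_{J+1}) + ε_J² + ε₀²) + |a| 𝔖²_{J+1} + r₀^{15/4} 𝔖_{J+1}^{3/2}(ε₀ + √ε_J √(𝔖_{J+1}+ℜ_{J+1}))^{1/2})`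
with `C = partIIIConst K₁ K₂ K₃` and the last term written as `𝔖_{J+1} · √(r₀^7 √r₀ · 𝔖_{J+1} · (…))` (the same real number,
see `rpow_form`).  Two steps the text leaves to the reader are made explicit: the intermediate term
`r₀^{15/2} 𝔖_{J+1}(ε₀ + √ε_J √(𝔖+ℜ))` of l.27238–27241 is dominated by the two displayed terms (`mul_le_sqrt_add_sq`:
either `𝔖_{J+1} ≥ r₀^{15/2}(…)` and it is `≤` the `𝔖^{3/2}` term, or it is `≤ r₀^{15}(…)² ≤ 2 r₀^{15}(ε₀² + ε_J(𝔖+ℜ))`), and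
`|a|² 𝔖² ≤ |a| 𝔖²` uses `|a| ≤ 1` (cell GAPS.md E16 N3).
[cite: GiorgiKlainermanSzeftel2022, §15.1.3 proof of (13.6.6), TeX l.27221–27261] -/
theorem partIII_arith {dP dB dBb aA aAb S1 R1 SJ RJ e e0 α ρ K1 K2 K3 : ℝ}
    (hdB : 0 ≤ dB) (hdBb : 0 ≤ dBb) (hS1 : 0 ≤ S1) (hR1 : 0 ≤ R1) (hSJ : 0 ≤ SJ) (hRJ : 0 ≤ RJ)
    (he : 0 ≤ e) (he0 : 0 ≤ e0) (hα : 0 ≤ α) (hα1 : α ≤ 1) (hρ : 1 ≤ ρ) (hK1 : 0 ≤ K1) (hK2 : 0 ≤ K2) (hK3 : 0 ≤ K3)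
    (hJ : SJ + RJ ≤ e)
    (h1 : dP ≤ K1 * ρ ^ 15 * (S1 * SJ + R1 * RJ + e ^ 2 + e0 ^ 2))
    (h2 : dB + dBb ≤ K2 * (dP + e0 ^ 2 + e ^ 2 + α ^ 2 * S1 ^ 2 + e * R1 + (Real.sqrt dP + e0 + e) * S1))
    (h3a : aA ≤ K3 * (dB + e0 ^ 2 + e ^ 2 + (Real.sqrt dB + e0 + e) * S1 + α ^ 2 * S1 ^ 2))
    (h3b : aAb ≤ K3 * (dBb + e0 ^ 2 + e ^ 2 + (Real.sqrt dBb + e0 + e) * S1 + α ^ 2 * S1 ^ 2)) :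
    dP + dB + dBb + aA + aAb ≤ partIIIConst K1 K2 K3 *
      (ρ ^ 15 * (e * (S1 + R1) + e ^ 2 + e0 ^ 2) + α * S1 ^ 2
        + S1 * Real.sqrt (ρ ^ 7 * Real.sqrt ρ * S1 * (e0 + Real.sqrt e * Real.sqrt (S1 + R1)))) := by
  -- names
  set Q := e * (S1 + R1) + e ^ 2 + e0 ^ 2 with hQdef
  set V := e0 + Real.sqrt e * Real.sqrt (S1 + R1) with hVdef
  set W := ρ ^ 15 * Q with hWdef
  set m := ρ ^ 7 * Real.sqrt ρ with hmdef           -- ρ^{15/2}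
  set U := ρ ^ 7 * Real.sqrt ρ * S1 * V with hUdef   -- ρ^{15/2} 𝔖 V
  set Z := S1 * Real.sqrt U with hZdef               -- ρ^{15/4} 𝔖^{3/2} V^{1/2}
  set A1 := α * S1 ^ 2 with hA1def
  -- signs and sizes
  have hρ0 : 0 ≤ ρ := by linarith
  have hQ : 0 ≤ Q := by positivity
  have hx0 : 0 ≤ Real.sqrt e * Real.sqrt (S1 + R1) := by positivity
  have hx2 : (Real.sqrt e * Real.sqrt (S1 + R1)) ^ 2 = e * (S1 + R1) := by
    rw [mul_pow, Real.sq_sqrt he, Real.sq_sqrt (by positivity)]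
  have hV : 0 ≤ V := by positivity
  have hVe0 : e0 ≤ V := by rw [hVdef]; linarith
  have hρ15 : 1 ≤ ρ ^ 15 := one_le_pow₀ hρ
  have hρ7 : 1 ≤ ρ ^ 7 := one_le_pow₀ hρ
  have hsρ : 1 ≤ Real.sqrt ρ := by rw [Real.le_sqrt (by norm_num) hρ0]; linarith
  have hm1 : 1 ≤ m := one_le_mul_of_one_le_of_one_le hρ7 hsρ
  have hm0 : 0 ≤ m := by linarith
  have hmsq : m ^ 2 = ρ ^ 15 := by rw [hmdef, mul_pow, Real.sq_sqrt hρ0]; ring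
  have hmle : m ≤ ρ ^ 15 := by
    have := le_mul_of_one_le_left hm0 hm1
    linarith [hmsq]
  have hW : Q ≤ W := le_mul_of_one_le_left hQ hρ15
  have hW0 : 0 ≤ W := hQ.trans hW
  have hUm : U = m * V * S1 := by rw [hUdef, hmdef]; ring
  have hU0 : 0 ≤ U := by rw [hUm]; positivity
  have hZ0 : 0 ≤ Z := by positivity
  have hA10 : 0 ≤ A1 := by positivity
  have hA20 : 0 ≤ α ^ 2 * S1 ^ 2 := by positivity
  have hA2 : α ^ 2 * S1 ^ 2 ≤ A1 := by
    rw [hA1def]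
    have h' : 0 ≤ α * (1 - α) := mul_nonneg hα (by linarith)
    have : α ^ 2 ≤ α := by linarith [h']
    exact mul_le_mul_of_nonneg_right this (by positivity)
  -- (A) Thm 14.1.3 + iteration assumption (13.6.4): dP ≤ K₁ W
  have hSJ' : SJ ≤ e := by linarith
  have hRJ' : RJ ≤ e := by linarith
  have hP0 : S1 * SJ + R1 * RJ + e ^ 2 + e0 ^ 2 ≤ Q := by
    have := mul_le_mul_of_nonneg_left hSJ' hS1
    have := mul_le_mul_of_nonneg_left hRJ' hR1
    rw [hQdef]; linarith
  have hdPW : dP ≤ K1 * W := by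
    calc dP ≤ K1 * ρ ^ 15 * (S1 * SJ + R1 * RJ + e ^ 2 + e0 ^ 2) := h1
      _ ≤ K1 * ρ ^ 15 * Q := mul_le_mul_of_nonneg_left hP0 (by positivity)
      _ = K1 * W := by rw [hWdef]; ring
  -- (B) √Q ≤ V + ε_J,  √W ≤ m (V + ε_J),  √dP · 𝔖 ≤ (1 + K₁)(U + W)
  have hsqQ : Real.sqrt Q ≤ V + e := by
    rw [Real.sqrt_le_left (by positivity)]
    have hV2 : e0 ^ 2 + e * (S1 + R1) ≤ V ^ 2 := by
      have : V ^ 2 = e0 ^ 2 + 2 * (e0 * (Real.sqrt e * Real.sqrt (S1 + R1)))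
          + (Real.sqrt e * Real.sqrt (S1 + R1)) ^ 2 := by rw [hVdef]; ring
      rw [this, hx2]
      have : 0 ≤ e0 * (Real.sqrt e * Real.sqrt (S1 + R1)) := mul_nonneg he0 hx0
      linarith
    have : (V + e) ^ 2 = V ^ 2 + 2 * (V * e) + e ^ 2 := by ring
    have : 0 ≤ V * e := mul_nonneg hV he
    rw [hQdef]
    linarith
  have hsqW : Real.sqrt W ≤ m * (V + e) := by
    rw [hWdef, Real.sqrt_mul' _ hQ, sqrt_pow_fifteen hρ0, ← hmdef]
    exact mul_le_mul_of_nonneg_left hsqQ hm0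
  have heS1Q : e * S1 ≤ Q := by
    have : 0 ≤ e * R1 := mul_nonneg he hR1
    rw [hQdef]; linarith [sq_nonneg e, sq_nonneg e0]
  have heS1 : e * S1 ≤ W := heS1Q.trans hW
  have heR1 : e * R1 ≤ W := by
    have : e * R1 ≤ Q := by
      have : 0 ≤ e * S1 := mul_nonneg he hS1
      rw [hQdef]; linarith [sq_nonneg e, sq_nonneg e0]
    exact this.trans hW
  have hee : e0 ^ 2 + e ^ 2 ≤ W := by
    have : e0 ^ 2 + e ^ 2 ≤ Q := by
      have : 0 ≤ e * (S1 + R1) := by positivity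
      rw [hQdef]; linarith
    exact this.trans hW
  have he0S1 : e0 * S1 ≤ U := by
    rw [hUm]
    have : V ≤ m * V := le_mul_of_one_le_left hV hm1
    exact mul_le_mul_of_nonneg_right (hVe0.trans this) hS1
  have hS1sqW : S1 * Real.sqrt W ≤ U + W := by
    have a1 : S1 * Real.sqrt W ≤ S1 * (m * (V + e)) := mul_le_mul_of_nonneg_left hsqW hS1
    have a2 : S1 * (m * (V + e)) = U + m * (e * S1) := by rw [hUm]; ring
    have a3 : m * (e * S1) ≤ ρ ^ 15 * (e * S1) := mul_le_mul_of_nonneg_right hmle (by positivity)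
    have a4 : ρ ^ 15 * (e * S1) ≤ W := by
      rw [hWdef]; exact mul_le_mul_of_nonneg_left heS1Q (by positivity)
    linarith
  have hsqdP : Real.sqrt dP * S1 ≤ (1 + K1) * (U + W) := by
    have a1 : Real.sqrt dP ≤ Real.sqrt K1 * Real.sqrt W := by
      rw [← Real.sqrt_mul hK1]; exact Real.sqrt_le_sqrt hdPW
    have a2 := mul_le_mul_of_nonneg_right a1 hS1
    have a3 : Real.sqrt K1 * (S1 * Real.sqrt W) ≤ Real.sqrt K1 * (U + W) :=
      mul_le_mul_of_nonneg_left hS1sqW (Real.sqrt_nonneg _)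
    have a4 : Real.sqrt K1 * (U + W) ≤ (1 + K1) * (U + W) :=
      mul_le_mul_of_nonneg_right (sqrt_le_one_add hK1) (by positivity)
    have a5 : Real.sqrt K1 * Real.sqrt W * S1 = Real.sqrt K1 * (S1 * Real.sqrt W) := by ring
    linarith
  -- (C) Prop 15.1.1: dB + dBb ≤ b₁ W + K₂ |a|²𝔖² + b₂ U   (the display l.27238–27241, with the
  --     r₀^{15/2}𝔖(…) term kept inside U)
  set b1 := K2 * (2 * K1 + 4) with hb1def
  set b2 := K2 * (K1 + 2) with hb2def
  have hb1 : 0 ≤ b1 := by positivity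
  have hb2 : 0 ≤ b2 := by positivity
  have hBsum : dB + dBb ≤ b1 * W + K2 * (α ^ 2 * S1 ^ 2) + b2 * U := by
    have inner : dP + e0 ^ 2 + e ^ 2 + α ^ 2 * S1 ^ 2 + e * R1 + (Real.sqrt dP + e0 + e) * S1
        ≤ (2 * K1 + 4) * W + α ^ 2 * S1 ^ 2 + (K1 + 2) * U := by
      have : (Real.sqrt dP + e0 + e) * S1 = Real.sqrt dP * S1 + e0 * S1 + e * S1 := by ring
      linarith
    have := mul_le_mul_of_nonneg_left inner hK2
    have e1 : K2 * ((2 * K1 + 4) * W + α ^ 2 * S1 ^ 2 + (K1 + 2) * U)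
        = b1 * W + K2 * (α ^ 2 * S1 ^ 2) + b2 * U := by rw [hb1def, hb2def]; ring
    linarith
  -- (D) √(δ[B]) 𝔖, √(δ[B̲]) 𝔖
  set Bb := b1 * W + K2 * (α ^ 2 * S1 ^ 2) + b2 * U with hBbdef
  have hBb0 : 0 ≤ Bb := by positivity
  have hsqBb : Real.sqrt Bb ≤
      Real.sqrt b1 * Real.sqrt W + Real.sqrt K2 * (α * S1) + Real.sqrt b2 * Real.sqrt U := by
    have s1 := sqrt_add_le (x := b1 * W + K2 * (α ^ 2 * S1 ^ 2)) (y := b2 * U) (by positivity) (by positivity)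
    have s2 := sqrt_add_le (x := b1 * W) (y := K2 * (α ^ 2 * S1 ^ 2)) (by positivity) (by positivity)
    have e1 : Real.sqrt (b1 * W) = Real.sqrt b1 * Real.sqrt W := Real.sqrt_mul hb1 _
    have e2 : Real.sqrt (K2 * (α ^ 2 * S1 ^ 2)) = Real.sqrt K2 * (α * S1) := by
      rw [Real.sqrt_mul hK2, ← mul_pow, Real.sqrt_sq (by positivity)]
    have e3 : Real.sqrt (b2 * U) = Real.sqrt b2 * Real.sqrt U := Real.sqrt_mul hb2 _
    rw [hBbdef]; linarith [s1, s2, e1, e2, e3]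
  have hsqS : ∀ d : ℝ, d ≤ Bb →
      Real.sqrt d * S1 ≤ (1 + b1) * (U + W) + (1 + K2) * A1 + (1 + b2) * Z := by
    intro d hdle
    have a0 : Real.sqrt d ≤ Real.sqrt Bb := Real.sqrt_le_sqrt hdle
    have a1 : Real.sqrt d * S1 ≤ Real.sqrt Bb * S1 := mul_le_mul_of_nonneg_right a0 hS1
    have a2 : Real.sqrt Bb * S1 ≤
        (Real.sqrt b1 * Real.sqrt W + Real.sqrt K2 * (α * S1) + Real.sqrt b2 * Real.sqrt U) * S1 :=
      mul_le_mul_of_nonneg_right hsqBb hS1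
    have a3 : (Real.sqrt b1 * Real.sqrt W + Real.sqrt K2 * (α * S1) + Real.sqrt b2 * Real.sqrt U) * S1
        = Real.sqrt b1 * (S1 * Real.sqrt W) + Real.sqrt K2 * A1 + Real.sqrt b2 * Z := by
      rw [hA1def, hZdef]; ring
    have a4 : Real.sqrt b1 * (S1 * Real.sqrt W) ≤ (1 + b1) * (U + W) := by
      have := mul_le_mul_of_nonneg_left hS1sqW (Real.sqrt_nonneg b1)
      have := mul_le_mul_of_nonneg_right (sqrt_le_one_add hb1) (add_nonneg hU0 hW0)
      linarith
    have a5 : Real.sqrt K2 * A1 ≤ (1 + K2) * A1 := mul_le_mul_of_nonneg_right (sqrt_le_one_add hK2) hA10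
    have a6 : Real.sqrt b2 * Z ≤ (1 + b2) * Z := mul_le_mul_of_nonneg_right (sqrt_le_one_add hb2) hZ0
    linarith
  have hsqdB := hsqS dB (by linarith [hBsum])
  have hsqdBb := hsqS dBb (by linarith [hBsum])
  -- (E) the dichotomy: U ≤ Z + 2 W
  have hUZ : U ≤ Z + 2 * W := by
    have d1 := mul_le_sqrt_add_sq hS1 (mul_nonneg hm0 hV : 0 ≤ m * V)
    have d2 : (m * V) * S1 = U := by rw [hUm]
    rw [d2] at d1
    have hV2 : V ^ 2 ≤ 2 * (e0 ^ 2 + e * (S1 + R1)) := by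
      have : V ^ 2 = e0 ^ 2 + 2 * (e0 * (Real.sqrt e * Real.sqrt (S1 + R1)))
          + (Real.sqrt e * Real.sqrt (S1 + R1)) ^ 2 := by rw [hVdef]; ring
      rw [this, hx2]
      linarith [sq_nonneg (e0 - Real.sqrt e * Real.sqrt (S1 + R1)), hx2]
    have hQ2 : e0 ^ 2 + e * (S1 + R1) ≤ Q := by rw [hQdef]; linarith [sq_nonneg e]
    have d3 : (m * V) ^ 2 ≤ 2 * W := by
      calc (m * V) ^ 2 = ρ ^ 15 * V ^ 2 := by rw [mul_pow, hmsq]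
        _ ≤ ρ ^ 15 * (2 * Q) := mul_le_mul_of_nonneg_left (by linarith) (by positivity)
        _ = 2 * W := by rw [hWdef]; ring
    have d4 : S1 * Real.sqrt U = Z := by rw [hZdef]
    linarith
  -- (F) Prop 15.1.2 and the total
  have hAA : aA + aAb ≤ K3 * (Bb + 2 * W + 2 * ((1 + b1) * (U + W) + (1 + K2) * A1 + (1 + b2) * Z)
      + 2 * U + 2 * W + 2 * (α ^ 2 * S1 ^ 2)) := by
    have inner : dB + e0 ^ 2 + e ^ 2 + (Real.sqrt dB + e0 + e) * S1 + α ^ 2 * S1 ^ 2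
        + (dBb + e0 ^ 2 + e ^ 2 + (Real.sqrt dBb + e0 + e) * S1 + α ^ 2 * S1 ^ 2)
        ≤ Bb + 2 * W + 2 * ((1 + b1) * (U + W) + (1 + K2) * A1 + (1 + b2) * Z)
          + 2 * U + 2 * W + 2 * (α ^ 2 * S1 ^ 2) := by
      have hB' : dB + dBb ≤ Bb := hBsum
      have r1 : (Real.sqrt dB + e0 + e) * S1 = Real.sqrt dB * S1 + e0 * S1 + e * S1 := by ring
      have r2 : (Real.sqrt dBb + e0 + e) * S1 = Real.sqrt dBb * S1 + e0 * S1 + e * S1 := by ring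
      linarith
    have := mul_le_mul_of_nonneg_left inner hK3
    linarith [h3a, h3b]
  -- collect: T ≤ cW W + cU U + cA A1 + cZ Z, then U ≤ Z + 2W
  have t0 := mul_le_mul_of_nonneg_left hBsum (by positivity : (0 : ℝ) ≤ 1 + K3)
  have t1 : (1 + K3) * K2 * (α ^ 2 * S1 ^ 2) ≤ (1 + K3) * K2 * A1 :=
    mul_le_mul_of_nonneg_left hA2 (by positivity)
  have t2 : 2 * K3 * (α ^ 2 * S1 ^ 2) ≤ 2 * K3 * A1 := mul_le_mul_of_nonneg_left hA2 (by positivity)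
  have hfinal : dP + dB + dBb + aA + aAb ≤
      (K1 + (1 + K3) * b1 + 4 * K3 + 2 * K3 * (1 + b1)) * W
      + ((1 + K3) * b2 + 2 * K3 + 2 * K3 * (1 + b1)) * U
      + ((1 + K3) * K2 + 2 * K3 + 2 * K3 * (1 + K2)) * A1
      + (2 * K3 * (1 + b2)) * Z := by
    rw [hBbdef] at hAA
    linarith [hdPW, hBsum, hAA, t0, t1, t2]
  have hcU : 0 ≤ (1 + K3) * b2 + 2 * K3 + 2 * K3 * (1 + b1) := by positivity
  have hcW : 0 ≤ K1 + (1 + K3) * b1 + 4 * K3 + 2 * K3 * (1 + b1) := by positivity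
  have hcA : 0 ≤ (1 + K3) * K2 + 2 * K3 + 2 * K3 * (1 + K2) := by positivity
  have hcZ : 0 ≤ 2 * K3 * (1 + b2) := by positivity
  have t3 := mul_le_mul_of_nonneg_left hUZ hcU
  have hC : partIIIConst K1 K2 K3 =
      (K1 + (1 + K3) * b1 + 4 * K3 + 2 * K3 * (1 + b1))
      + 2 * ((1 + K3) * b2 + 2 * K3 + 2 * K3 * (1 + b1))
      + ((1 + K3) * K2 + 2 * K3 + 2 * K3 * (1 + K2))
      + 2 * K3 * (1 + b2) := by rw [partIIIConst, hb1def, hb2def]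
  rw [hC]
  have n1 := mul_nonneg hcW (add_nonneg hA10 hZ0)
  have n2 := mul_nonneg hcU hA10
  have n3 := mul_nonneg hcA (add_nonneg hW0 hZ0)
  have n4 := mul_nonneg hcZ (add_nonneg hW0 hA10)
  have n5 := mul_nonneg hcU hZ0
  linarith


/-! ## Part C. The `r^p`-form of the last term and the assembly over the tree's statement shapes. -/

/-- `r₀³ · 𝔖 · √(r₀^7 √r₀ · 𝔖 · V) = r₀^{27/4} · 𝔖^{3/2} · √V` (`r₀ ≥ 1`, `𝔖, V ≥ 0`): the last term of (13.6.6) in the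
`Real.rpow` form used by `CurvatureEstimateShapes.ControlOfCurvature_GKS`. [folklore] -/
theorem rpow_form {ρ S V : ℝ} (hρ : 1 ≤ ρ) (hS : 0 ≤ S) (hV : 0 ≤ V) :
    ρ ^ 3 * (S * Real.sqrt (ρ ^ 7 * Real.sqrt ρ * S * V)) = rp ρ (27 / 4) * rp S (3 / 2) * Real.sqrt V := by
  have hρ0 : 0 < ρ := by linarith
  simp only [rp, Real.rpow_eq_pow]
  have e1 : Real.sqrt (ρ ^ 7 * Real.sqrt ρ * S * V)
      = Real.sqrt (ρ ^ 7 * Real.sqrt ρ) * Real.sqrt S * Real.sqrt V := by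
    rw [Real.sqrt_mul' _ hV, Real.sqrt_mul' _ hS]
  have e2 : ρ ^ 7 * Real.sqrt ρ = ρ ^ ((15 : ℝ) / 2) := by
    rw [Real.sqrt_eq_rpow, ← Real.rpow_natCast ρ 7, ← Real.rpow_add hρ0]; norm_num
  have e3 : Real.sqrt (ρ ^ 7 * Real.sqrt ρ) = ρ ^ ((15 : ℝ) / 4) := by
    rw [e2, Real.sqrt_eq_rpow, ← Real.rpow_mul hρ0.le]; norm_num
  have e4 : ρ ^ 3 * ρ ^ ((15 : ℝ) / 4) = ρ ^ ((27 : ℝ) / 4) := by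
    rw [← Real.rpow_natCast ρ 3, ← Real.rpow_add hρ0]; norm_num
  have e5 : S ^ ((3 : ℝ) / 2) = S * Real.sqrt S := by
    rw [show ((3 : ℝ) / 2) = 1 + 1 / 2 by norm_num, Real.rpow_add' hS (by norm_num), Real.rpow_one,
      Real.sqrt_eq_rpow]
  calc ρ ^ 3 * (S * Real.sqrt (ρ ^ 7 * Real.sqrt ρ * S * V))
      = (ρ ^ 3 * Real.sqrt (ρ ^ 7 * Real.sqrt ρ)) * (S * Real.sqrt S) * Real.sqrt V := by rw [e1]; ring
    _ = ρ ^ ((27 : ℝ) / 4) * S ^ ((3 : ℝ) / 2) * Real.sqrt V := by rw [e3, e4, e5]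

/-- **(iv) of the cell's GAPS.md E16 — the comparison `ℜint²_{J+1} ≲ r₀³ · BEF_δ^J[A, B, P̌, B̲, A̲]`** (GKS l.27262–27264:
"in view of the definition of ℜ^{int}_k in section 13.5 and the one of B^k_δ in section 14.1.1", no proof printed;
the cell's referee certifies the factor r₀³ from the definitions l.25750–25757, l.26064–26070), typed as a statement
shape with hidden constant `K` in the cell's `Schema` convention, with `BEF_δ^J[A,B,P̌,B̲,A̲]` READ AS THE SUM of the
five norms (GAPS E16 N2: the symbol is never defined in [GKS]; the sum is the only reading consistent with §15.1.3).
Statement shape, not asserted.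
[cite: GiorgiKlainermanSzeftel2022, §15.1.3 display "ℜint²_{J+1} ≲ r₀³ BEF^J_δ[A,B,P̌,B̲,A̲]", TeX l.27262–27264] -/
def RintFromBEF (X : CurvBEFData) (_P : KerrParams) (F : Fixed) (_S : Small) (K : ℝ) : Prop :=
  ∀ (x : X.Sol) (J : ℕ), F.kL ≤ 2 * J → J + 1 ≤ F.kL →
    X.Rint x (J + 1) ^ 2 ≤
      K * F.r0 ^ 3 * (X.BEFJ x .r2A J + X.BEFJ x .r2B J + X.BEFJ x .r2Pc J + X.BEFJ x .Bb J + X.BEFJ x .Ab J)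

/-- The hidden constant of Theorem 13.6.3 produced by the assembly: `K₄ · partIIIConst K₁ K₂ K₃ + K₁₆` (`K₄` from the
comparison (iv), `K₁₆` from Thm 16.1.1). [cite: GiorgiKlainermanSzeftel2022, Thm 13.6.3 via §15.1.3, TeX l.27221–27266] -/
def curvConst (K1 K2 K3 K4 K16 : ℝ) : ℝ := K4 * partIIIConst K1 K2 K3 + K16

/-- **GKS Theorem 13.6.3 ⇐ Thm 14.1.3 + Prop 15.1.1 + Prop 15.1.2 + (iv) + Thm 16.1.1, kernel-checked over the tree's
statement shapes** (the node "GKS13.6.3 ⇐ 14.1.3 + 15.1.1 + 15.1.2 + 16.1.1" of the audit cell's DAG; GKS §15.1.3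
l.27221–27266 for (13.6.6), and (13.6.7) = Thm 16.1.1 verbatim, cell GAPS.md E16 (v)).  HYPOTHESES: the four displayed
estimates as the shapes `MorawetzEnergyPc`, `EstimatesBBb`, `EstimatesAAb`, `MainResultMext` of
`CurvatureEstimateShapes` with hidden constants `K₁, K₂, K₃, K₁₆ ≥ 0`, the comparison shape `RintFromBEF` with `K₄ ≥ 0`;
SIGN CONVENTIONS the shapes leave implicit (norms and `BEF` values `≥ 0`, `ε_J ≥ 0`, `ε₀ ≥ 0`); `r₀ ≥ 1`; and
`|a| ≤ 1` (GAPS E16 N3: the step `|a|²𝔖² ≤ |a|𝔖²` of l.27250).  CONCLUSION: `ControlOfCurvature_GKS` (both displays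
(13.6.6)–(13.6.7)) with the explicit hidden constant `curvConst K₁ K₂ K₃ K₄ K₁₆`, independent of `r₀` as [GKS] states.
The hypotheses (13.6.1)–(13.6.3), (13.6.5) of Theorem 13.6.3 are threaded through unused (they are consumed inside the
leaves).  Nothing of [GKS] is asserted; nothing here is Final-State-Conjecture progress.
[cite: GiorgiKlainermanSzeftel2022, Thm 13.6.3 (13.6.6)–(13.6.7) and §15.1.3, TeX l.25953–25972, l.27221–27266; journal GiorgiKlainermanSzeftel2024 Thm 13.6.3, HAL p.626–627] -/
theorem controlOfCurvature_GKS_of_parts (X : CurvBEFData) (P : KerrParams) (F : Fixed) (S : Small)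
    {K1 K2 K3 K4 K16 : ℝ}
    (h14 : MorawetzEnergyPc X P F S K1) (h15a : EstimatesBBb X P F S K2) (h15b : EstimatesAAb X P F S K3)
    (hRint : RintFromBEF X P F S K4) (h16 : MainResultMext X.toCurvData P F S K16)
    (hK1 : 0 ≤ K1) (hK2 : 0 ≤ K2) (hK3 : 0 ≤ K3) (hK4 : 0 ≤ K4) (hK16 : 0 ≤ K16)
    (hr0 : 1 ≤ F.r0) (he0 : 0 ≤ S.ε0) (ha1 : |P.a| ≤ 1)
    (hBEF : ∀ x c J, 0 ≤ X.BEFJ x c J) (hSnn : ∀ x k, 0 ≤ X.S x k) (hRnn : ∀ x k, 0 ≤ X.R x k)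
    (hepsJ : ∀ J, 0 ≤ X.epsJ J) :
    ControlOfCurvature_GKS X.toCurvData P F S (curvConst K1 K2 K3 K4 K16) := by
  intro x J hJ1 hJ2 _hI _hBoot _hLow _hFrame hIter
  have h1 := h14 x J hJ1 hJ2 hIter
  have h2 := h15a x J hJ1 hJ2 hIter
  obtain ⟨h3a, h3b⟩ := h15b x J hJ1 hJ2 hIter
  have h4 := hRint x J hJ1 hJ2
  have h5 := h16 x J hJ1 hJ2 hIter
  have hC : 0 ≤ partIIIConst K1 K2 K3 := partIIIConst_nonneg hK1 hK2 hK3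
  have hS1 := hSnn x (J + 1)
  have hR1 := hRnn x (J + 1)
  have hr00 : 0 ≤ F.r0 := by linarith
  set Q := X.epsJ J * (X.S x (J + 1) + X.R x (J + 1)) + X.epsJ J ^ 2 + S.ε0 ^ 2 with hQdef
  set V := S.ε0 + Real.sqrt (X.epsJ J) * Real.sqrt (X.S x (J + 1) + X.R x (J + 1)) with hVdef
  have hQ : 0 ≤ Q := by have := hepsJ J; positivity
  have hV : 0 ≤ V := by positivity
  have hRHS : 0 ≤ F.r0 ^ 18 * Q + |P.a| * F.r0 ^ 3 * X.S x (J + 1) ^ 2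
      + rp F.r0 (27 / 4) * rp (X.S x (J + 1)) (3 / 2) * Real.sqrt V := by
    have : 0 ≤ rp F.r0 (27 / 4) := Real.rpow_nonneg hr00 _
    have : 0 ≤ rp (X.S x (J + 1)) (3 / 2) := Real.rpow_nonneg hS1 _
    positivity
  refine ⟨?_, ?_⟩
  · -- (13.6.6)
    have core := partIII_arith (hBEF x .r2B J) (hBEF x .Bb J) hS1 hR1 (hSnn x J) (hRnn x J) (hepsJ J) he0
      (abs_nonneg P.a) ha1 hr0 hK1 hK2 hK3 hIter h1 h2 h3a h3b
    -- core : dP + dB + dBb + aA + aAb ≤ C * (r₀^15 Q + |a| 𝔖² + 𝔖 √(…))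
    have hsum : X.BEFJ x .r2A J + X.BEFJ x .r2B J + X.BEFJ x .r2Pc J + X.BEFJ x .Bb J + X.BEFJ x .Ab J
        ≤ partIIIConst K1 K2 K3 * (F.r0 ^ 15 * Q + |P.a| * X.S x (J + 1) ^ 2
          + X.S x (J + 1) * Real.sqrt (F.r0 ^ 7 * Real.sqrt F.r0 * X.S x (J + 1) * V)) := by
      rw [hQdef, hVdef]; linarith [core]
    have hstep : X.Rint x (J + 1) ^ 2 ≤ K4 * F.r0 ^ 3 * (partIIIConst K1 K2 K3 * (F.r0 ^ 15 * Q
        + |P.a| * X.S x (J + 1) ^ 2 + X.S x (J + 1) * Real.sqrt (F.r0 ^ 7 * Real.sqrt F.r0 * X.S x (J + 1) * V))) :=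
      h4.trans (mul_le_mul_of_nonneg_left hsum (by positivity))
    have hZ := rpow_form hr0 hS1 hV
    have e1 : K4 * F.r0 ^ 3 * (partIIIConst K1 K2 K3 * (F.r0 ^ 15 * Q + |P.a| * X.S x (J + 1) ^ 2
        + X.S x (J + 1) * Real.sqrt (F.r0 ^ 7 * Real.sqrt F.r0 * X.S x (J + 1) * V)))
        = K4 * partIIIConst K1 K2 K3 * (F.r0 ^ 18 * Q + |P.a| * F.r0 ^ 3 * X.S x (J + 1) ^ 2
          + F.r0 ^ 3 * (X.S x (J + 1) * Real.sqrt (F.r0 ^ 7 * Real.sqrt F.r0 * X.S x (J + 1) * V))) := by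
      ring
    rw [e1, hZ] at hstep
    have hmono : K4 * partIIIConst K1 K2 K3 * (F.r0 ^ 18 * Q + |P.a| * F.r0 ^ 3 * X.S x (J + 1) ^ 2
        + rp F.r0 (27 / 4) * rp (X.S x (J + 1)) (3 / 2) * Real.sqrt V)
        ≤ curvConst K1 K2 K3 K4 K16 * (F.r0 ^ 18 * Q + |P.a| * F.r0 ^ 3 * X.S x (J + 1) ^ 2
          + rp F.r0 (27 / 4) * rp (X.S x (J + 1)) (3 / 2) * Real.sqrt V) := by
      unfold curvConst
      exact mul_le_mul_of_nonneg_right (by linarith) hRHS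
    rw [hQdef, hVdef] at hstep hmono
    exact hstep.trans hmono
  · -- (13.6.7) = Thm 16.1.1 verbatim, constant enlarged
    have hRHS2 : 0 ≤ rp F.r0 (3 + F.δB) * X.Rint x (J + 1) ^ 2 + rp F.r0 (-F.δB) * X.Sext x (J + 1) ^ 2
        + X.epsJ J ^ 2 + S.ε0 ^ 2 := by
      have : 0 ≤ rp F.r0 (3 + F.δB) := Real.rpow_nonneg hr00 _
      have : 0 ≤ rp F.r0 (-F.δB) := Real.rpow_nonneg hr00 _
      positivity
    have hmono : K16 * (rp F.r0 (3 + F.δB) * X.Rint x (J + 1) ^ 2 + rp F.r0 (-F.δB) * X.Sext x (J + 1) ^ 2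
        + X.epsJ J ^ 2 + S.ε0 ^ 2) ≤ curvConst K1 K2 K3 K4 K16 * (rp F.r0 (3 + F.δB) * X.Rint x (J + 1) ^ 2
        + rp F.r0 (-F.δB) * X.Sext x (J + 1) ^ 2 + X.epsJ J ^ 2 + S.ε0 ^ 2) := by
      unfold curvConst
      exact mul_le_mul_of_nonneg_right (by nlinarith) hRHS2
    exact h5.trans hmono

/-- `curvConst ≥ 0`. [folklore] -/
theorem curvConst_nonneg {K1 K2 K3 K4 K16 : ℝ} (hK1 : 0 ≤ K1) (hK2 : 0 ≤ K2) (hK3 : 0 ≤ K3) (hK4 : 0 ≤ K4)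
    (hK16 : 0 ≤ K16) : 0 ≤ curvConst K1 K2 K3 K4 K16 := by
  have := partIIIConst_nonneg hK1 hK2 hK3
  unfold curvConst; positivity

/-- The same assembly landing in the JOURNAL display of Theorem 13.6.3 (`ControlOfCurvature_GKSj`, PAMQ 2024
(13.6.7)–(13.6.8) with the extra `(ℜ_{J+1}+𝔖_{J+1})²` terms), via `ControlOfCurvature_GKSj.of_v1`.
[cite: GiorgiKlainermanSzeftel2024, Thm 13.6.3 (13.6.7)–(13.6.8), HAL p.626–627] -/
theorem controlOfCurvature_GKSj_of_parts (X : CurvBEFData) (P : KerrParams) (F : Fixed) (S : Small)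
    {K1 K2 K3 K4 K16 : ℝ}
    (h14 : MorawetzEnergyPc X P F S K1) (h15a : EstimatesBBb X P F S K2) (h15b : EstimatesAAb X P F S K3)
    (hRint : RintFromBEF X P F S K4) (h16 : MainResultMext X.toCurvData P F S K16)
    (hK1 : 0 ≤ K1) (hK2 : 0 ≤ K2) (hK3 : 0 ≤ K3) (hK4 : 0 ≤ K4) (hK16 : 0 ≤ K16)
    (hr0 : 1 ≤ F.r0) (he0 : 0 ≤ S.ε0) (ha1 : |P.a| ≤ 1)
    (hBEF : ∀ x c J, 0 ≤ X.BEFJ x c J) (hSnn : ∀ x k, 0 ≤ X.S x k) (hRnn : ∀ x k, 0 ≤ X.R x k)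
    (hepsJ : ∀ J, 0 ≤ X.epsJ J) :
    ControlOfCurvature_GKSj X.toCurvData P F S (curvConst K1 K2 K3 K4 K16) :=
  ControlOfCurvature_GKSj.of_v1 (curvConst_nonneg hK1 hK2 hK3 hK4 hK16)
    (controlOfCurvature_GKS_of_parts X P F S h14 h15a h15b hRint h16 hK1 hK2 hK3 hK4 hK16 hr0 he0 ha1 hBEF hSnn
      hRnn hepsJ)

end Literature.Geometry.Lorentzian.GiorgiKlainermanSzeftel2022.CurvatureAssembly

end
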